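import Summits.ABC.ABC.Theorems.RibetTakahashiSplitManyPrimeValuationProductStubFermatInputKnown

/-!
# The Fermat input of Pasten's cokernel bound where it is known, II: the Fermat extraction and
# the Frey–Hellegouarch case

Sequel of `Summits.ABC.ABC.Theorems.RibetTakahashiSplitManyPrimeValuationProductStubFermatInputKnown`
(helpers `--supports` stmt-ABC-1561, stub `stub_fermatInputKnown` of the line
`jl-zero-cycle-height`). Here:

* the FERMAT EXTRACTION of Pasten's proof of Lemma 6.12 (arXiv:1705.09251, §6.5), as pure
  arithmetic: for coprime `a, b` with `ab(a+b) ≠ 0` and an odd prime `ℓ`, if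
  `ℓ ∣ 2 v_p(ab(a+b))` for every odd prime `p` then `a + b = c` yields
  `x ^ ℓ + 2 ^ m y ^ ℓ + z ^ ℓ = 0` in pairwise coprime integers, `x, z` odd, `xyz ≠ 0`,
  `0 ≤ m < ℓ`, every odd prime of `ab(a+b)` dividing `xyz`
  (`exists_genFermat_of_dvd_factorization`, via `genFermat_normal_form`);
* case (B) reduced to its Diophantine core (`exists_not_dvd_factorization_of_smul_eq_freyCurve`):
  for `W ≅ freyCurve (d a) (d b)` (`d ∣ 2`) with `≥ 2` multiplicative primes, the Fermat input at
  an odd prime `ℓ` follows from "every such solution has `|xyz| ≤ 1`" at exponent `ℓ` — which for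
  a prime `ℓ ≥ 5` is H. Cohen, *Number Theory II* (GTM 240), Thm 15.3.1 (S. Siksek's chapter) =
  Wiles 1995 (`m = 0`), Ribet, Acta Arith. 79 (1997) (`m ≥ 2`), Darmon–Merel, J. reine angew.
  Math. 490 (1997) (`m = 1`: only `±(1, −1, 1)`);
* the assembly `fermatInputKnown_of` = the skeleton's `FermatInputKnown` with its abbreviations
  unfolded, conditional on exactly the two published inputs (Pasten L.6.11 at `ℓ`; the
  generalized-Fermat statement at `ℓ`), and `fermatInputKnown_of_mestreOesterle`, where input (A)
  is the tree's named fact `mestreOesterle1989_thm_1`.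

Truth-level remarks recorded for the line: the threshold `ℓ ≥ 11` is Pasten's (Mazur's Thm 4 for
semistable curves); in case (B) any odd prime `ℓ ≥ 5` would do; the prime `2` never needs to be
examined (the argument runs through the odd multiplicative primes, which for a twisted Frey curve
are exactly the odd primes of `ab(a+b)`); the degenerate triples `{|a|, |b|, |a+b|} = {1, 1, 2}`
are excluded by `2 ≤ #multPrimes` (their curves have conductor a power of `2`).
-/

-- `Summit.ABC.ABC` is the mandated summit-side namespace (CONVENTIONS §2); the duplicate is deliberate.
set_option linter.dupNamespace false

namespace Summit.ABC.ABC.Theorems.ManyPrimeValuationProduct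

open WeierstrassCurve Literature.NumberTheory.EllipticCurves

/-! ## The Fermat extraction (arithmetic part of Pasten's Lemma 6.12) -/

section Extraction

/-- For coprime nonzero `u, w`: if `ℓ ∣ v_p(uw)` then `ℓ ∣ v_p(u)` (at most one of `v_p(u)`,
`v_p(w)` is nonzero). `[folklore]` -/
theorem dvd_factorization_natAbs_of_isCoprime {u w : ℤ} {p ℓ : ℕ} (huw : IsCoprime u w)
    (hu : u ≠ 0) (hw : w ≠ 0) (hp : p.Prime) (h : ℓ ∣ (u * w).natAbs.factorization p) :
    ℓ ∣ u.natAbs.factorization p := by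
  rw [Int.natAbs_mul, Nat.factorization_mul (Int.natAbs_ne_zero.mpr hu) (Int.natAbs_ne_zero.mpr hw),
    Finsupp.add_apply] at h
  by_cases hpu : (p : ℤ) ∣ u
  · have hpw : ¬ (p : ℤ) ∣ w := fun hpw =>
      (Nat.prime_iff_prime_int.mp hp).not_unit (huw.isUnit_of_dvd' hpu hpw)
    rwa [Nat.factorization_eq_zero_of_not_dvd (fun h' => hpw (Int.natCast_dvd.mpr h')),
      add_zero] at h
  · rw [Nat.factorization_eq_zero_of_not_dvd (fun h' => hpu (Int.natCast_dvd.mpr h'))]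
    exact dvd_zero _

/-- If `ℓ` is odd and `ℓ ∣ v_p(u)` for every odd prime `p` (`u ≠ 0`), then `u = 2 ^ {v₂(u)} · x ^ ℓ`
with `x` odd (the sign is absorbed into `x` because `ℓ` is odd). `[folklore]` -/
theorem exists_eq_two_pow_mul_pow_int {u : ℤ} {ℓ : ℕ} (hu : u ≠ 0) (hℓ : Odd ℓ)
    (h : ∀ p : ℕ, p.Prime → p ≠ 2 → ℓ ∣ u.natAbs.factorization p) :
    ∃ x : ℤ, Odd x ∧ u = 2 ^ u.natAbs.factorization 2 * x ^ ℓ := by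
  obtain ⟨k, hk, hku⟩ :=
    exists_eq_two_pow_mul_pow_of_dvd_factorization (Int.natAbs_ne_zero.mpr hu) hℓ.pos.ne' h
  set e := u.natAbs.factorization 2 with he
  have hcast : (u.natAbs : ℤ) = 2 ^ e * (k : ℤ) ^ ℓ := by rw [hku]; push_cast; ring
  have hsign : u.sign ^ ℓ = u.sign := by
    rcases lt_trichotomy u 0 with hneg | rfl | hpos
    · rw [Int.sign_eq_neg_one_of_neg hneg, hℓ.neg_one_pow]
    · exact absurd rfl hu
    · rw [Int.sign_eq_one_of_pos hpos, one_pow]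
  refine ⟨u.sign * k, ?_, ?_⟩
  · refine Int.odd_mul.mpr ⟨?_, (Int.odd_coe_nat k).mpr hk⟩
    rcases lt_trichotomy u 0 with hneg | rfl | hpos
    · rw [Int.sign_eq_neg_one_of_neg hneg]; exact odd_neg_one
    · exact absurd rfl hu
    · rw [Int.sign_eq_one_of_pos hpos]; exact odd_one
  · calc u = u.sign * (u.natAbs : ℤ) := (Int.sign_mul_natAbs u).symm
      _ = 2 ^ e * (u.sign * k) ^ ℓ := by rw [hcast, mul_pow, hsign]; ring

/-- For odd `u`, `v₂(|u|) = 0`. `[folklore]` -/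
theorem factorization_two_eq_zero_of_odd {u : ℤ} (hu : Odd u) : u.natAbs.factorization 2 = 0 :=
  Nat.factorization_eq_zero_of_not_dvd
    (Nat.two_dvd_ne_zero.mpr (Nat.odd_iff.mp (Int.natAbs_odd.mpr hu)))

/-- **Normal form of a primitive solution.** From `u₁ + u₂ + u₃ = 0` with the `uᵢ` pairwise
coprime and nonzero, `u₁ = X ^ ℓ`, `u₃ = Z ^ ℓ` (`X`, `Z` odd) and `u₂ = 2 ^ e · y₀ ^ ℓ`, one
gets `x ^ ℓ + 2 ^ m y ^ ℓ + z ^ ℓ = 0` with `0 ≤ m < ℓ`, `x, y, z` pairwise coprime, `x, z` odd,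
`xyz ≠ 0`, and every odd prime of `u₁ u₂ u₃` dividing `xyz` (reduce `e` modulo `ℓ`:
`y = 2 ^ {⌊e/ℓ⌋} y₀`). `[folklore]` -/
theorem genFermat_normal_form {ℓ : ℕ} (hℓ : ℓ ≠ 0) {u₁ u₂ u₃ X y₀ Z : ℤ} {e : ℕ}
    (hsum : u₁ + u₂ + u₃ = 0) (h12 : IsCoprime u₁ u₂) (h13 : IsCoprime u₁ u₃)
    (h23 : IsCoprime u₂ u₃) (h0 : u₁ * u₂ * u₃ ≠ 0) (hX : Odd X) (hZ : Odd Z)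
    (hu₁ : u₁ = X ^ ℓ) (hu₂ : u₂ = 2 ^ e * y₀ ^ ℓ) (hu₃ : u₃ = Z ^ ℓ) :
    ∃ (x y z : ℤ) (m : ℕ), m < ℓ ∧ IsCoprime x y ∧ IsCoprime x z ∧ IsCoprime y z ∧ Odd x ∧
      Odd z ∧ x * y * z ≠ 0 ∧ x ^ ℓ + 2 ^ m * y ^ ℓ + z ^ ℓ = 0 ∧
      ∀ p : ℕ, p.Prime → p ≠ 2 → (p : ℤ) ∣ u₁ * u₂ * u₃ → (p : ℤ) ∣ x * y * z := by
  set Y : ℤ := 2 ^ (e / ℓ) * y₀ with hY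
  have key : (2 : ℤ) ^ e * y₀ ^ ℓ = 2 ^ (e % ℓ) * Y ^ ℓ := by
    rw [hY, mul_pow, ← pow_mul, ← mul_assoc, ← pow_add, Nat.mod_add_div' e ℓ]
  have hXd : X ∣ u₁ := by rw [hu₁]; exact dvd_pow_self _ hℓ
  have hYd : Y ∣ u₂ := by rw [hu₂, key]; exact dvd_mul_of_dvd_right (dvd_pow_self _ hℓ) _
  have hZd : Z ∣ u₃ := by rw [hu₃]; exact dvd_pow_self _ hℓ
  have h1 : u₁ ≠ 0 := fun h => h0 (by rw [h]; ring)
  have h2 : u₂ ≠ 0 := fun h => h0 (by rw [h]; ring)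
  have h3 : u₃ ≠ 0 := fun h => h0 (by rw [h]; ring)
  have hX0 : X ≠ 0 := fun h => h1 (zero_dvd_iff.mp (h ▸ hXd))
  have hY0 : Y ≠ 0 := fun h => h2 (zero_dvd_iff.mp (h ▸ hYd))
  have hZ0 : Z ≠ 0 := fun h => h3 (zero_dvd_iff.mp (h ▸ hZd))
  refine ⟨X, Y, Z, e % ℓ, Nat.mod_lt _ (Nat.pos_of_ne_zero hℓ),
    (h12.of_isCoprime_of_dvd_left hXd).of_isCoprime_of_dvd_right hYd,
    (h13.of_isCoprime_of_dvd_left hXd).of_isCoprime_of_dvd_right hZd,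
    (h23.of_isCoprime_of_dvd_left hYd).of_isCoprime_of_dvd_right hZd, hX, hZ,
    mul_ne_zero (mul_ne_zero hX0 hY0) hZ0, ?_, fun p hp hp2 hpd => ?_⟩
  · rw [← key, ← hu₁, ← hu₂, ← hu₃]; exact hsum
  · have hpint : Prime (p : ℤ) := Nat.prime_iff_prime_int.mp hp
    rcases hpint.dvd_or_dvd hpd with hpd | hpd
    · rcases hpint.dvd_or_dvd hpd with hpd | hpd
      · rw [hu₁] at hpd
        exact dvd_mul_of_dvd_left (dvd_mul_of_dvd_left (hpint.dvd_of_dvd_pow hpd) _) _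
      · rw [hu₂, key] at hpd
        rcases hpint.dvd_or_dvd hpd with hpd | hpd
        · exact absurd (hpint.dvd_of_dvd_pow hpd) (not_dvd_of_dvd_two (dvd_refl 2) hp hp2)
        · exact dvd_mul_of_dvd_left (dvd_mul_of_dvd_right (hpint.dvd_of_dvd_pow hpd) _) _
    · rw [hu₃] at hpd
      exact dvd_mul_of_dvd_right (hpint.dvd_of_dvd_pow hpd) _

/-- **The Fermat extraction** (Pasten, arXiv:1705.09251, proof of Lemma 6.12: "Since `a, b, c` are
pairwise coprime we see that the odd parts of them are perfect `ℓ`-th powers. Exactly one of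
`a, b, c` is even, so the equation `a + b = c` yields a solution of `x^ℓ + 2^m y^ℓ + z^ℓ = 0` in
pairwise coprime integers `x, y, z` with `x` and `z` odd, `xyz ≠ 0`, and `0 ≤ m < ℓ`"). For
coprime `a, b` with `ab(a+b) ≠ 0` and an odd prime `ℓ`: if `ℓ ∣ 2 v_p(ab(a+b))` for every odd
prime `p`, then there are such `x, y, z, m`, and moreover every odd prime of `ab(a+b)` divides
`xyz`. `[folklore]` -/
theorem exists_genFermat_of_dvd_factorization {a b : ℤ} {ℓ : ℕ} (hab : IsCoprime a b)
    (h0 : a * b * (a + b) ≠ 0) (hℓ : ℓ.Prime) (hℓ2 : ℓ ≠ 2)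
    (h : ∀ p : ℕ, p.Prime → p ≠ 2 → ℓ ∣ 2 * (a * b * (a + b)).natAbs.factorization p) :
    ∃ (x y z : ℤ) (m : ℕ), m < ℓ ∧ IsCoprime x y ∧ IsCoprime x z ∧ IsCoprime y z ∧ Odd x ∧
      Odd z ∧ x * y * z ≠ 0 ∧ x ^ ℓ + 2 ^ m * y ^ ℓ + z ^ ℓ = 0 ∧
      ∀ p : ℕ, p.Prime → p ≠ 2 → (p : ℤ) ∣ a * b * (a + b) → (p : ℤ) ∣ x * y * z := by
  have hℓodd : Odd ℓ := hℓ.odd_of_ne_two hℓ2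
  have ha0 : a ≠ 0 := fun h' => h0 (by rw [h']; ring)
  have hb0 : b ≠ 0 := fun h' => h0 (by rw [h']; ring)
  have hc0 : a + b ≠ 0 := fun h' => h0 (by rw [h']; ring)
  have hac : IsCoprime a (a + b) := by simpa using hab.mul_add_left_right 1
  have hbc : IsCoprime b (a + b) := by simpa using hab.symm.add_mul_left_right 1
  have h' : ∀ p : ℕ, p.Prime → p ≠ 2 → ℓ ∣ (a * b * (a + b)).natAbs.factorization p :=
    fun p hp hp2 => ((Nat.coprime_primes hℓ Nat.prime_two).mpr hℓ2).dvd_of_dvd_mul_left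
      ((mul_comm 2 _) ▸ h p hp hp2)
  -- each of `a`, `b`, `-(a + b)` is `2 ^ e · (odd ℓ-th power)`
  obtain ⟨xa, hxa, ha⟩ := exists_eq_two_pow_mul_pow_int ha0 hℓodd fun p hp hp2 =>
    dvd_factorization_natAbs_of_isCoprime (hab.mul_right hac) ha0 (mul_ne_zero hb0 hc0) hp
      (by rw [← mul_assoc]; exact h' p hp hp2)
  obtain ⟨xb, hxb, hb⟩ := exists_eq_two_pow_mul_pow_int hb0 hℓodd fun p hp hp2 =>
    dvd_factorization_natAbs_of_isCoprime (hab.symm.mul_right hbc) hb0 (mul_ne_zero ha0 hc0) hp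
      (by rw [show b * (a * (a + b)) = a * b * (a + b) by ring]; exact h' p hp hp2)
  obtain ⟨xc, hxc, hc⟩ := exists_eq_two_pow_mul_pow_int (neg_ne_zero.mpr hc0) hℓodd fun p hp hp2 =>
    dvd_factorization_natAbs_of_isCoprime (hac.symm.mul_right hbc.symm).neg_left
      (neg_ne_zero.mpr hc0) (mul_ne_zero ha0 hb0) hp
      (by rw [show -(a + b) * (a * b) = -(a * b * (a + b)) by ring, Int.natAbs_neg]; exact h' p hp hp2)
  have hdvd : ∀ {u : ℤ} (p : ℕ), u = -(a * b * (a + b)) → (p : ℤ) ∣ a * b * (a + b) → (p : ℤ) ∣ u :=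
    fun p hu hp => by rw [hu]; exact (dvd_neg).mpr hp
  -- exactly one of `a`, `b`, `a + b` is even
  rcases Int.even_or_odd a with ha2 | ha2
  · have hb2 : Odd b := by
      by_contra hb2; rw [Int.not_odd_iff_even] at hb2
      exact Int.prime_two.not_unit (hab.isUnit_of_dvd' ha2.two_dvd hb2.two_dvd)
    have hc2 : Odd (-(a + b)) := (ha2.add_odd hb2).neg
    rw [factorization_two_eq_zero_of_odd hb2, pow_zero, one_mul] at hb
    rw [factorization_two_eq_zero_of_odd hc2, pow_zero, one_mul] at hc
    obtain ⟨x, y, z, m, H⟩ := genFermat_normal_form hℓ.ne_zero (u₁ := b) (u₂ := a) (u₃ := -(a + b))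
      (by ring) hab.symm hbc.neg_right hac.neg_right
      (by rw [show b * a * -(a + b) = -(a * b * (a + b)) by ring]; exact neg_ne_zero.mpr h0)
      hxb hxc hb ha hc
    exact ⟨x, y, z, m, H.1, H.2.1, H.2.2.1, H.2.2.2.1, H.2.2.2.2.1, H.2.2.2.2.2.1, H.2.2.2.2.2.2.1,
      H.2.2.2.2.2.2.2.1, fun p hp hp2 hpd => H.2.2.2.2.2.2.2.2 p hp hp2 (hdvd p (by ring) hpd)⟩
  · rcases Int.even_or_odd b with hb2 | hb2
    · have hc2 : Odd (-(a + b)) := (ha2.add_even hb2).neg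
      rw [factorization_two_eq_zero_of_odd ha2, pow_zero, one_mul] at ha
      rw [factorization_two_eq_zero_of_odd hc2, pow_zero, one_mul] at hc
      obtain ⟨x, y, z, m, H⟩ := genFermat_normal_form hℓ.ne_zero (u₁ := a) (u₂ := b) (u₃ := -(a + b))
        (by ring) hab hac.neg_right hbc.neg_right
        (by rw [show a * b * -(a + b) = -(a * b * (a + b)) by ring]; exact neg_ne_zero.mpr h0)
        hxa hxc ha hb hc
      exact ⟨x, y, z, m, H.1, H.2.1, H.2.2.1, H.2.2.2.1, H.2.2.2.2.1, H.2.2.2.2.2.1, H.2.2.2.2.2.2.1,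
        H.2.2.2.2.2.2.2.1, fun p hp hp2 hpd => H.2.2.2.2.2.2.2.2 p hp hp2 (hdvd p (by ring) hpd)⟩
    · rw [factorization_two_eq_zero_of_odd ha2, pow_zero, one_mul] at ha
      rw [factorization_two_eq_zero_of_odd hb2, pow_zero, one_mul] at hb
      obtain ⟨x, y, z, m, H⟩ := genFermat_normal_form hℓ.ne_zero (u₁ := a) (u₂ := -(a + b)) (u₃ := b)
        (by ring) hac.neg_right hab hbc.neg_right.symm
        (by rw [show a * -(a + b) * b = -(a * b * (a + b)) by ring]; exact neg_ne_zero.mpr h0)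
        hxa hxb ha hc hb
      exact ⟨x, y, z, m, H.1, H.2.1, H.2.2.1, H.2.2.2.1, H.2.2.2.2.1, H.2.2.2.2.2.1, H.2.2.2.2.2.2.1,
        H.2.2.2.2.2.2.2.1, fun p hp hp2 hpd => H.2.2.2.2.2.2.2.2 p hp hp2 (hdvd p (by ring) hpd)⟩

end Extraction

/-! ## Case (B): Frey–Hellegouarch curves and their twists by `±1, ±2` -/

/-- **Case (B) of the Fermat input, reduced to its Diophantine core.** Let `ℓ` be an odd prime
such that every solution of `x ^ ℓ + 2 ^ m · y ^ ℓ + z ^ ℓ = 0`, `0 ≤ m < ℓ`, in pairwise coprime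
integers with `x, z` odd has `|xyz| ≤ 1` — for a prime `ℓ ≥ 5` this is H. Cohen, *Number Theory II*
(GTM 240, 2007), Thm 15.3.1 (chapter by S. Siksek): "Let `p ≥ 5` be a prime. The equation
`x^p + 2^r y^p + z^p = 0` has no solution with `xyz ≠ 0` and `x, y, z` pairwise coprime, except when
`r = 1`, for which it has the solutions `(x, y, z) = ±(1, −1, 1)`. This theorem is the celebrated
theorem of Wiles for `r = 0`, and it was proved by Ribet [Acta Arith. 79 (1997)] for `r ≥ 2`, and
by Darmon–Merel [J. reine angew. Math. 490 (1997)] for `r = 1`", i.e. exactly the three inputs of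
Pasten, arXiv:1705.09251, proof of Lemma 6.12. Then for every elliptic
`W/ℚ` that is `ℚ`-isomorphic to a twisted Frey–Hellegouarch curve `y² = x (x − da) (x + db)`
(`a, b` coprime, `ab(a+b) ≠ 0`, `d ∣ 2`, i.e. `d ∈ {±1, ±2}`) and has at least two multiplicative
primes, some multiplicative prime `r` has `ℓ ∤ ord_r(Δ_min)`. Proof: otherwise `ℓ ∣ ord_p(Δ_min) =
2 v_p(ab(a+b))` at every odd prime `p` (all odd primes of `ab(a+b)` are multiplicative), the Fermat
extraction produces a solution with `|xyz| = 1`, so `ab(a+b)` has no odd prime factor, `N` is a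
power of `2`, and there is at most one multiplicative prime. `[folklore]` -/
theorem exists_not_dvd_factorization_of_smul_eq_freyCurve {ℓ : ℕ} (hℓ : ℓ.Prime) (hℓ2 : ℓ ≠ 2)
    (H : ∀ (x y z : ℤ) (m : ℕ), m < ℓ → IsCoprime x y → IsCoprime x z → IsCoprime y z → Odd x →
      Odd z → x ^ ℓ + 2 ^ m * y ^ ℓ + z ^ ℓ = 0 → (x * y * z).natAbs ≤ 1)
    (W : WeierstrassCurve ℚ) [W.IsElliptic] {a b d : ℤ} {C : VariableChange ℚ}
    (hab : IsCoprime a b) (h0 : a * b * (a + b) ≠ 0) (hd : d ∣ 2)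
    (hC : C • W = freyCurve (d * a) (d * b))
    (h2 : 2 ≤ ((W.conductorNorm ℤ).primeFactors.filter (fun p => ¬ p ^ 2 ∣ W.conductorNorm ℤ)).card) :
    ∃ r ∈ (W.conductorNorm ℤ).primeFactors.filter (fun p => ¬ p ^ 2 ∣ W.conductorNorm ℤ),
      ¬ ℓ ∣ (W.minimalDiscriminantNorm ℤ).factorization r := by
  have hN : W.conductorNorm ℤ = (freyCurve (d * a) (d * b)).conductorNorm ℤ :=
    conductorNorm_eq_of_smul_eq hC
  have hΔ : W.minimalDiscriminantNorm ℤ = (freyCurve (d * a) (d * b)).minimalDiscriminantNorm ℤ :=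
    minimalDiscriminantNorm_eq_of_smul_eq hC
  have hN0 : W.conductorNorm ℤ ≠ 0 := (conductorNorm_pos_holds W).ne'
  by_contra hall
  push Not at hall
  -- every odd-prime exponent of `(ab(a+b))²` is a multiple of `ℓ`
  have hdiv : ∀ p : ℕ, p.Prime → p ≠ 2 → ℓ ∣ 2 * (a * b * (a + b)).natAbs.factorization p := by
    intro p hp hp2
    by_cases hpm : (p : ℤ) ∣ a * b * (a + b)
    · have hfN := factorization_conductorNorm_freyCurve_twist hab h0 hd hp hp2
      rw [← hN, if_pos hpm] at hfN
      have hpN : p ∣ W.conductorNorm ℤ := Nat.dvd_of_factorization_pos (by rw [hfN]; exact one_ne_zero)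
      have hp2N : ¬ p ^ 2 ∣ W.conductorNorm ℤ := fun h => by
        have := (hp.pow_dvd_iff_le_factorization hN0).mp h; rw [hfN] at this; omega
      have := hall p (Finset.mem_filter.mpr ⟨Nat.mem_primeFactors.mpr ⟨hp, hpN, hN0⟩, hp2N⟩)
      rwa [hΔ, factorization_minimalDiscriminantNorm_freyCurve_twist hab h0 hd hp hp2] at this
    · rw [Nat.factorization_eq_zero_of_not_dvd (fun h' => hpm (Int.natCast_dvd.mpr h')), mul_zero]
      exact dvd_zero _
  obtain ⟨x, y, z, m, hm, hxy, hxz, hyz, hx, hz, hxyz, heq, hp⟩ :=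
    exists_genFermat_of_dvd_factorization hab h0 hℓ hℓ2 hdiv
  have h1 : (x * y * z).natAbs = 1 := by
    have := H x y z m hm hxy hxz hyz hx hz heq
    have h0' : (x * y * z).natAbs ≠ 0 := Int.natAbs_ne_zero.mpr hxyz
    omega
  -- hence no odd prime divides `ab(a+b)`: `N` is a power of `2`, at most one multiplicative prime
  have hodd : ∀ p : ℕ, p.Prime → p ≠ 2 → ¬ (p : ℤ) ∣ a * b * (a + b) := by
    intro p hpp hp2 hpd
    have := Int.natCast_dvd.mp (hp p hpp hp2 hpd)
    rw [h1, Nat.dvd_one] at this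
    exact hpp.one_lt.ne' this
  have hsub : (W.conductorNorm ℤ).primeFactors.filter (fun p => ¬ p ^ 2 ∣ W.conductorNorm ℤ) ⊆ {2} := by
    intro p hpmem
    rw [Finset.mem_singleton]
    have hpF := (Finset.mem_filter.mp hpmem).1
    have hpp := Nat.prime_of_mem_primeFactors hpF
    by_contra hp2
    have hfN := factorization_conductorNorm_freyCurve_twist hab h0 hd hpp hp2
    rw [← hN, if_neg (hodd p hpp hp2)] at hfN
    rw [← Nat.support_factorization, Finsupp.mem_support_iff] at hpF
    exact hpF hfN
  have := (Finset.card_le_card hsub).trans_eq (Finset.card_singleton 2)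
  omega

/-! ## Assembly in the shape of the skeleton's `FermatInputKnown` -/

/-- **`FermatInputKnown` of the line `jl-zero-cycle-height`, conditional on its two published
inputs** — with the skeleton's abbreviations `multPrimes`, `IsSemistableAwayFromTwo`,
`FermatInput`, `IsSemistable`, `IsFreyIsomorphic` unfolded, so that
`stub_fermatInputKnown` is literally `fermatInputKnown_of h611 hFermat`. The inputs, indexed by the
prime `ℓ ≥ 11`: (`h611`) no semistable elliptic curve over `ℚ` has `|Δ_min|` a perfect `ℓ`-th
power of an integer `≥ 2` — Pasten, arXiv:1705.09251, Lemma 6.11 (Mazur Thm 4, Ribet, Wiles), or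
Mestre–Oesterlé's Théorème 1 (the tree's named fact `mestreOesterle1989_thm_1`, via
`mestreOesterle1989_thm_1_iff_cases`); (`hFermat`) `x ^ ℓ + 2 ^ m y ^ ℓ + z ^ ℓ = 0`, `0 ≤ m < ℓ`,
has no solution in pairwise coprime integers with `x, z` odd and `|xyz| > 1` — Cohen, *Number
Theory II* (GTM 240), Thm 15.3.1 for every prime `ℓ ≥ 5` (= Wiles `m = 0`, Ribet 1997 `m ≥ 2`,
Darmon–Merel 1997 `m = 1`), the three inputs of Pasten's proof of Lemma 6.12. The skeleton's hypothesis
"semistable away from `2`" is not needed (and omitted here), and `4 ≤ #multPrimes` is used only as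
`2 ≤ #multPrimes` (to exclude the triple `1 + 1 = 2`, whose twisted Frey curves have conductor a
power of `2`).
`[folklore]` -/
theorem fermatInputKnown_of
    (h611 : ∀ ℓ : ℕ, ℓ.Prime → 11 ≤ ℓ → ∀ (W : WeierstrassCurve ℚ) [W.IsElliptic],
      W.IsSemistable ℤ → ∀ k : ℕ, 2 ≤ k → W.minimalDiscriminantNorm ℤ ≠ k ^ ℓ)
    (hFermat : ∀ ℓ : ℕ, ℓ.Prime → 11 ≤ ℓ → ∀ (x y z : ℤ) (m : ℕ), m < ℓ → IsCoprime x y →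
      IsCoprime x z → IsCoprime y z → Odd x → Odd z → x ^ ℓ + 2 ^ m * y ^ ℓ + z ^ ℓ = 0 →
      (x * y * z).natAbs ≤ 1)
    (W : WeierstrassCurve ℚ) [W.IsElliptic]
    (h4 : 4 ≤ ((W.conductorNorm ℤ).primeFactors.filter (fun p => ¬ p ^ 2 ∣ W.conductorNorm ℤ)).card)
    (hAB : (∀ p : ℕ, p.Prime → ¬ p ^ 2 ∣ W.conductorNorm ℤ) ∨
      ∃ (a b d : ℤ) (C : VariableChange ℚ), IsCoprime a b ∧ a * b * (a + b) ≠ 0 ∧ d ∣ 2 ∧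
        C • W = freyCurve (d * a) (d * b)) :
    ∀ ℓ : ℕ, ℓ.Prime → 11 ≤ ℓ →
      ∃ r ∈ (W.conductorNorm ℤ).primeFactors.filter (fun p => ¬ p ^ 2 ∣ W.conductorNorm ℤ),
        ¬ ℓ ∣ (W.minimalDiscriminantNorm ℤ).factorization r := by
  intro ℓ hℓ h11
  rcases hAB with hss | ⟨a, b, d, C, hab, h0, hd, hC⟩
  · refine exists_not_dvd_factorization_of_semistable (h611 ℓ hℓ h11) W hss ?_
    obtain ⟨p, hp⟩ : ((W.conductorNorm ℤ).primeFactors.filter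
        (fun p => ¬ p ^ 2 ∣ W.conductorNorm ℤ)).Nonempty := Finset.card_pos.mp (by omega)
    exact ⟨p, (Finset.mem_filter.mp hp).1⟩
  · exact exists_not_dvd_factorization_of_smul_eq_freyCurve hℓ (by omega) (hFermat ℓ hℓ h11) W hab h0
      hd hC (by omega)

/-- **Registered sub-goal of `stub_fermatInputKnown`: `FermatInputKnown` (the skeleton's
statement with `multPrimes`, `IsSemistableAwayFromTwo`, `FermatInput`, `IsSemistable`,
`IsFreyIsomorphic` unfolded) from its two published inputs, indexed by the prime `ℓ ≥ 11`** —
(i) the `ℓ`-th power exclusion for semistable curves (Pasten, arXiv:1705.09251, Lemma 6.11; or the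
tree's named fact `mestreOesterle1989_thm_1`), (ii) the generalized-Fermat statement
`x^ℓ + 2^m y^ℓ + z^ℓ = 0 ⟹ |xyz| ≤ 1` (Cohen GTM 240 Thm 15.3.1 = Wiles + Ribet 1997 +
Darmon–Merel 1997). So `stub_fermatInputKnown` is `fermatInputKnown_of_inputs h611 hFermat` by
`rfl`-unfolding. Binder-free restatement of `fermatInputKnown_of` (the form registered with
`ledger workitem stub-add stmt-ABC-1561 --name fermatInputKnown_of_inputs`). `[folklore]` -/
theorem fermatInputKnown_of_inputs : (∀ ℓ : ℕ, ℓ.Prime → 11 ≤ ℓ → ∀ (W : WeierstrassCurve ℚ) [W.IsElliptic], W.IsSemistable ℤ → ∀ k : ℕ, 2 ≤ k → W.minimalDiscriminantNorm ℤ ≠ k ^ ℓ) → (∀ ℓ : ℕ, ℓ.Prime → 11 ≤ ℓ → ∀ (x y z : ℤ) (m : ℕ), m < ℓ → IsCoprime x y → IsCoprime x z → IsCoprime y z → Odd x → Odd z → x ^ ℓ + 2 ^ m * y ^ ℓ + z ^ ℓ = 0 → (x * y * z).natAbs ≤ 1) → ∀ (W : WeierstrassCurve ℚ) [W.IsElliptic],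 (∀ p : ℕ, p.Prime → p ≠ 2 → ¬ p ^ 2 ∣ W.conductorNorm ℤ) → 4 ≤ ((W.conductorNorm ℤ).primeFactors.filter (fun p => ¬ p ^ 2 ∣ W.conductorNorm ℤ)).card → ((∀ p : ℕ, p.Prime → ¬ p ^ 2 ∣ W.conductorNorm ℤ) ∨ ∃ (a b d : ℤ) (C : WeierstrassCurve.VariableChange ℚ), IsCoprime a b ∧ a * b * (a + b) ≠ 0 ∧ d ∣ 2 ∧ C • W = Literature.NumberTheory.EllipticCurves.freyCurve (d * a) (d * b)) → ∀ ℓ : ℕ, ℓ.Prime → 11 ≤ ℓ → ∃ r ∈ (W.conductorNorm ℤ).primeFactors.filter (fun p => ¬ p ^ 2 ∣ W.conductorNorm ℤ), ¬ ℓ ∣ (W.minimalDiscriminantNorm ℤ).factorization r :=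
  fun h611 hFermat W _ _ h4 hAB => fermatInputKnown_of h611 hFermat W h4 hAB

/-- The same with input (A) taken from the tree's named fact `mestreOesterle1989_thm_1`
(Mestre–Oesterlé 1989, Théorème 1), leaving only the generalized-Fermat input `hFermat`
(Cohen GTM 240 Thm 15.3.1 at each prime `ℓ ≥ 11`: Wiles; Ribet 1997; Darmon–Merel 1997).
`[folklore]` -/
theorem fermatInputKnown_of_mestreOesterle (hMO : mestreOesterle1989_thm_1)
    (hFermat : ∀ ℓ : ℕ, ℓ.Prime → 11 ≤ ℓ → ∀ (x y z : ℤ) (m : ℕ), m < ℓ → IsCoprime x y →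
      IsCoprime x z → IsCoprime y z → Odd x → Odd z → x ^ ℓ + 2 ^ m * y ^ ℓ + z ^ ℓ = 0 →
      (x * y * z).natAbs ≤ 1)
    (W : WeierstrassCurve ℚ) [W.IsElliptic]
    (h4 : 4 ≤ ((W.conductorNorm ℤ).primeFactors.filter (fun p => ¬ p ^ 2 ∣ W.conductorNorm ℤ)).card)
    (hAB : (∀ p : ℕ, p.Prime → ¬ p ^ 2 ∣ W.conductorNorm ℤ) ∨
      ∃ (a b d : ℤ) (C : VariableChange ℚ), IsCoprime a b ∧ a * b * (a + b) ≠ 0 ∧ d ∣ 2 ∧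
        C • W = freyCurve (d * a) (d * b)) :
    ∀ ℓ : ℕ, ℓ.Prime → 11 ≤ ℓ →
      ∃ r ∈ (W.conductorNorm ℤ).primeFactors.filter (fun p => ¬ p ^ 2 ∣ W.conductorNorm ℤ),
        ¬ ℓ ∣ (W.minimalDiscriminantNorm ℤ).factorization r :=
  fermatInputKnown_of ((mestreOesterle1989_thm_1_iff_cases.mp hMO).1) hFermat W h4 hAB

end Summit.ABC.ABC.Theorems.ManyPrimeValuationProduct
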